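import Literature.NumberTheory.Automorphic.BrandtXi
import Literature.NumberTheory.DiophantineGeometry.Conductor
import Literature.NumberTheory.EllipticCurves.Rank1Residual.Predicates
import HarnessLib

/-!
# Pollack–Weston 2011, Lemma 2.1: the pairing `⟨·, g_f⟩` on the definite Picard module takes a unit
# value (the normalisation "`1 ∈ im ψ_f`") — NAMED FACT, statement only

Sixth file touching the definite Gross-points / Brandt-module story of an elliptic curve
(`GrossPoints`, …, `GrossPointsThetaElementSupersingular`, which vendors Pollack–Weston's Thm. 2.5 (i)
as the named fact `pollackWeston2011_thm_2_5_hasMuZeroLAc` and KEEPS the present lemma as that fact's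
explicit hypothesis `∃ c, ¬ p ∣ w_c φ_c`). Typed for cell `bsd-ssimc`, line «defmu» of crux 2
`KobayashiLowerHalfSemistable` (stmt-BirchSwinnertonDyer-19000): it is, VERBATIM, the displayed
hypothesis `hL21` of `Summit.….Theorems.SemistableDefmuOddPrime.threeResidual_of_citePacks`
(file `Summits/…/Theorems/SignedLowerHalvesKobayashiLowerHalfSemistableDefmuOddPrimeThree.lean`).
HONEST FRAMING: nothing is proved about any curve here; the lemma is a `def … : Prop` (D-0014), to be
taken as a hypothesis `(h : pollackWeston2011_lemma21_exists_not_dvd_weight_mul)`.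

## Source, verbatim (read 2026-08-29 on the arXiv text `paper:arxiv-math_0610694` = Compos. Math. 147
## (2011) 1353–1381; page/line references are to that materialisation)

* **Notation** (p. 4): "Fix an odd prime `p` … Let `K/ℚ` be an imaginary quadratic field with
  discriminant `D` prime to `p`. … If `N` is an integer relatively prime to `D`, we write `N⁺` (resp.
  `N⁻`) for the largest divisor of `N` divisible only by primes split (resp. inert) in `K/ℚ`. Let
  `f = Σ a_n qⁿ` denote a normalized newform of weight two, squarefree level `N = N⁺N⁻` prime to `pD`,
  and trivial nebentypus. We assume throughout this paper that `N⁻` has an odd number of prime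
  factors. … `𝒪₀` the `ℤ_p`-subalgebra of `ℚ̄_p` generated by the … Fourier coefficients of `f` … `𝒪`
  [its] integral closure".
* **Hypothesis (CR)** (p. 2): "Throughout the paper we will be imposing the following hypotheses on
  `N⁻` and `ρ̄_f` …: A continuous Galois representation `ρ̄ : G_ℚ → GL₂(𝔽̄_p)` and a squarefree product
  `N⁻` of an odd number of primes, each inert in `K/ℚ`, including all such primes at which `ρ̄` is
  ramified, satisfies hypothesis CR if: • `ρ̄` is surjective; • if `q ∣ N⁻` and `q ≡ ±1 (mod p)`,
  then `ρ̄` is ramified at `q`."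
* **§2.1** (p. 5): "Let `X_{N⁺,N⁻}` denote the Shimura curve of level `N⁺` attached to the definite
  quaternion algebra ramified at the primes dividing `N⁻`. If `ℳ = Pic(X_{N⁺,N⁻}) ⊗ ℤ_p`, then `ℳ`
  has a natural faithful action of `𝕋`. In the construction of the `p`-adic `L`-function `L_p(f)`,
  one chooses a linear map `ψ_f : ℳ → 𝒪` that is `𝕋`-equivariant … By scaling by a constant of `𝒪`,
  we can and do insist that `1` be in the image of `ψ_f`. … Let `ℳ^f` denote the submodule of
  `ℳ ⊗ 𝒪` on which `𝕋` acts via `π_f`. Then `ℳ^f` is a free `𝒪`-module of rank 1; let `g_f` denote a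
  generator of this module. The Hecke-module `ℳ` is equipped with an intersection pairing
  `⟨·,·⟩ : ℳ × ℳ → ℤ_p` under which the action of `𝕋` is adjoint.
  **Lemma 2.1.** There is some `m ∈ ℳ` such that `⟨m, g_f⟩` is a unit.
  We prove this lemma by relating `ℳ` to a character group arising from a Shimura curve attached
  to an indefinite quaternion algebra and then invoking results of [T]. … Assuming this lemma, we
  may take the map `ψ_f` to be defined by `ψ_f(x) = ⟨x, g_f⟩`."
* **§6.3, proof** (p. 15): "**Proposition 6.5.** For each `r ∣ N⁻`, there is a canonical
  Hecke-equivariant isomorphism `Pic(X_{N⁺,N⁻}) ⊗ 𝒪 ≅ 𝒳_r(N⁺r, N⁻/r)`. Moreover, this isomorphism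
  takes the intersection pairing on `Pic(X_{N⁺,N⁻})` to the monodromy pairing on `𝒳_r(N⁺r, N⁻/r)`.
  *Proof.* See [Kohel]. … *Proof of Lemma 2.1.* Let `r` be any divisor of `N⁻`. By Proposition 6.5,
  we have `ℳ = Pic(X_{N⁺,N⁻}) ⊗ 𝒪 ≅ 𝒳_r(N⁺r, N⁻/r)`. Thus, the lemma follows from [T] which proves
  the analogous statement for the character group `𝒳_r(N⁺r, N⁻/r)`." ([T] = Takahashi, J. Number
  Theory 90 (2001); [Kohel] = Kohel, Adv. Stud. Pure Math. 30 (2001).)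

## Dictionary (tree ↔ PW) and rendering

* `ℳ = Pic(X_{N⁺,N⁻}) ⊗ ℤ_p`: `Pic X = ℤ[Cls O]` is the free module on the class set
  `Brandt.ClassSet S.O` of the Eichler order `S.O` of level `N⁺` in the definite quaternion algebra
  of discriminant `N⁻` of a Brandt setup `S : Brandt.XiSetup N⁺ N⁻` (file `BrandtXi`; Voight 41.1:
  the Hecke operator `T(n)[I_j] = Σ_i (Brandt.matrix S.O n)_{ij} [I_i]` acts on DIVISOR coordinates
  `x : Cls O → ℤ` by `Matrix.mulVec`). The pairing "under which the action of `𝕋` is adjoint" is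
  Gross's `⟨e_c, e_d⟩ = w_c δ_{cd}`, `w_c = Brandt.weight S.O c = #O_L(I_c)ˣ/2` (Gross 1987 §4;
  Voight 41.1.3; the tree's `GrossRep.yValue`, "`ψ_f(x) = ⟨x, g_f⟩`").
* `f = f_E` for `E/ℚ` (model `W`) of squarefree conductor `N_E = N⁺N⁻` (modularity, [BCDT]); then
  `𝒪 = ℤ_p`, the eigenvalue system is `(a_n(E))_n = fun n => W.LFunction n`, and `ℳ^f = ℤ_p ⊗ L`
  for the tree's SATURATED common eigen-lattice
  `L = Brandt.eigenLattice (N⁺N⁻) (Brandt.matrix S.O) (a(E)) ⊆ ℤ^{Cls O}` (Hecke operators at the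
  primes `ℓ ∤ N`; `ℳ^f`, cut out by all of `𝕋`, is a saturated rank-one submodule of it, hence equal
  to it when `L = ℤ φ` is a line). So "`g_f` a generator of `ℳ^f`" is rendered, as in
  `pollackWeston2011_thm_2_5_hasMuZeroLAc`, by `φ ≠ 0 ∧ L = ℤ ∙ φ` (`g_f = unit · φ`).
* "There is some `m ∈ ℳ` such that `⟨m, g_f⟩` is a unit": `⟨m, φ⟩ = Σ_c m_c w_c φ_c` for
  `m : Cls O → ℤ_p`, and `Σ_c m_c w_c φ_c ∈ ℤ_pˣ` for some `m` iff some `w_c φ_c` is a `p`-adic unit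
  (if every `w_c φ_c ∈ pℤ_p` so is every `⟨m, φ⟩`; conversely take `m = e_c`), i.e.
  `∃ c, ¬ p ∣ w_c φ_c` — the image of `ψ_f = ⟨·, g_f⟩` is the ideal of `ℤ_p` generated by the
  `w_c φ_c`. This is exactly the hypothesis `hnorm` kept explicit in
  `pollackWeston2011_thm_2_5_hasMuZeroLAc` (whose module docstring gives the same reading).
* Hypotheses, as the paper's standing assumptions specialise to `f = f_E`: `p` odd (`p ≠ 2`);
  `N⁺N⁻ = N_E` squarefree, `p ∤ N⁺N⁻`; `N⁻` squarefree with an odd number of prime factors and an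
  Eichler order of level `N⁺` (existence of `S`); (CR): `ρ̄_{E,p}` surjective (`Rank1Residual.Surj W p`
  = `W.HasSurjectiveModNGaloisRep p`) and — in the STRONGER form the consumer carries, "ramified
  branch" — `ρ̄_{E,p}` ramified at EVERY prime `q ∣ N⁻`, transcribed on the minimal discriminant as
  `¬ p ∣ v_q(Δ_W)` for a globally minimal `W` (Tate's parametrisation at the multiplicative prime
  `q`: `ρ̄_{E,p}` is unramified at `q ∥ N_E` iff `p ∣ v_q(Δ_min)`; the transcription of
  `Rank1Residual.Ram`). The field `K` enters neither the statement nor the proof of the lemma (it only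
  names the factorisation `N = N⁺N⁻`; an imaginary quadratic `K` with `(D, pN) = 1` in which the primes
  of `N⁺` split and those of `N⁻` are inert always exists), so it is not a binder — as in the consumer.
* TODO(general form): (CR) as printed only asks ramification at the `q ∣ N⁻` with `q ≡ ±1 (mod p)`,
  and `f` may be a non-rational newform (`𝒪 ⊋ ℤ_p`); the tree's Brandt module is `ℤ`-valued and the
  consumer needs the rational, everywhere-ramified case only. For `p ≥ 5` the conclusion is automatic
  (`w_c ∣ 12`, `φ` primitive: Summit-side theorem `SemistableDefmuMuCarrierV4.exists_not_dvd_weight_mul_apply`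
  from the tree's `Brandt.XiSetup.weight_dvd_twelve`); the content of the fact is at `p = 3`.

NOT vendored: Prop. 6.5 [Kohel] and Takahashi's character-group statement themselves (the tree's
Takahashi material lives in `TakahashiDegreeFormula*.lean`, `RibetTakahashiDefinite*.lean`); Lemma 2.2
(`Ω = (f,f)/ξ_f`). presearch (2026-08-29): tree — `lean search pollackWeston2011_lemma21` / `Lemma 2.1`:
none (only the hypothesis inside `pollackWeston2011_thm_2_5_hasMuZeroLAc` and the `p ≥ 5` Summit
theorem); corpus — [paper:arxiv-math_0610694 p. 5, p. 15] the lemma and its proof, [paper:arxiv-1905.02926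
(Kim–Ota 2019) §5.1–§6] the Chida–Hsieh-style integral normalisation of `f_B` by mod-`p` non-vanishing
(same content, no new proof for weight 2); `lit search --hybrid` / `lit vsearch` ("element of the Picard
group of the definite Shimura curve whose pairing with g_f is a p-adic unit") and galaxy
`"anticyclotomic mu-invariant|Pollack-Weston|image of psi_f" --star all`: nothing further.

## References

* [PollackWeston2011] R. Pollack, T. Weston, *On anticyclotomic μ-invariants of modular forms*, Compos.
  Math. 147 (2011) 1353–1381, arXiv:math/0610694 — §1 (CR), Notation, §2.1 Lemma 2.1, §6.3 Prop. 6.5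
  and proof of Lemma 2.1 (read).
* [Takahashi2001] S. Takahashi, *Degrees of parametrizations of elliptic curves by Shimura curves*,
  J. Number Theory 90 (2001) 74–88 (PW's [T]; cited through PW).
* [Kohel2001] D. Kohel, *Hecke module structure of quaternions*, Adv. Stud. Pure Math. 30 (2001)
  (PW's [Kohel]; cited through PW).
* [Voight2021] J. Voight, *Quaternion algebras*, GTM 288, §41.1 (Brandt matrices, `w_i`).
-/

noncomputable section

open Literature.NumberTheory.Automorphic

namespace Literature.NumberTheory.EllipticCurves

/-! ### Pollack–Weston 2011, Lemma 2.1 (named fact) -/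

section Fact

/-- **Pollack–Weston 2011, Lemma 2.1** ("There is some `m ∈ ℳ` such that `⟨m, g_f⟩` is a unit",
`ℳ = Pic(X_{N⁺,N⁻}) ⊗ ℤ_p`, `g_f` a generator of the rank-one `π_f`-eigenmodule `ℳ^f`, `⟨·,·⟩` the
intersection pairing; equivalently the `𝕋`-equivariant functional `ψ_f = ⟨·, g_f⟩ : ℳ → 𝒪` has `1`
in its image — the normalisation under which the anticyclotomic `p`-adic `L`-functions `L_p(f)`,
`λ_f^±` of §2 are defined), for `f = f_E` and in the tree's coordinates (module docstring): let `p`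
be an odd prime and `E/ℚ` (globally minimal model `W`) an elliptic curve of squarefree conductor
`N_E = N⁺N⁻` with `p ∤ N_E`; let `S` be a Brandt setup of type `(N⁺, N⁻)` (definite quaternion
algebra of discriminant `N⁻` — so `N⁻` is a squarefree product of an odd number of primes — with an
Eichler order `O` of level `N⁺`); assume (CR) in the ramified branch: `ρ̄_{E,p}` is surjective and
ramified at every prime `q ∣ N⁻` (`p ∤ v_q(Δ_E)`). Then for every generator `φ` of the
`a(E)`-eigen-line of the Brandt module `ℤ[Cls O]` (`φ ≠ 0`, eigen-lattice `= ℤ φ`; Pollack–Weston's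
`g_f` up to a `p`-adic unit) there is a class `c` with `p ∤ w_c φ_c`, `w_c = #O_L(I_c)ˣ/2` — i.e.
`ψ_f(e_c) = ⟨e_c, g_f⟩` is a `p`-adic unit (rendering: module docstring). Printed proof:
Prop. 6.5 ([Kohel]: `Pic(X_{N⁺,N⁻}) ⊗ 𝒪 ≅ 𝒳_r(N⁺r, N⁻/r)` compatibly with the pairings) and
"the lemma follows from [T]" (Takahashi 2001). This is the hypothesis `hnorm` of
`pollackWeston2011_thm_2_5_hasMuZeroLAc` and, verbatim, the binder `hL21` of
`SemistableDefmuOddPrime.threeResidual_of_citePacks`; for `p ≥ 5` it holds unconditionally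
(`w_c ∣ 12`), its content is at `p = 3`. Statement only; special case `𝒪 = ℤ_p`, all `q ∣ N⁻`
ramified (see TODO(general form) in the module docstring).
[cite: PollackWeston2011, §2.1 Lemma 2.1; proof in §6.3 via Prop. 6.5 (arXiv:math/0610694 pp. 5, 15)] -/
def pollackWeston2011_lemma21_exists_not_dvd_weight_mul : Prop :=
  ∀ (p : ℕ) [Fact p.Prime] (W : WeierstrassCurve ℚ) [W.IsElliptic] [W.IsGloballyMinimal]
    {Nplus Nminus : ℕ} (S : Brandt.XiSetup Nplus Nminus) [Fintype (Brandt.ClassSet S.O)],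
    p ≠ 2 → Nplus * Nminus = W.conductorNorm ℤ → Squarefree (Nplus * Nminus) → ¬ p ∣ Nplus * Nminus →
    Rank1Residual.Surj W p → (∀ q : ℕ, q.Prime → q ∣ Nminus → ¬ ((p : ℤ) ∣ padicValRat q W.Δ)) →
    ∀ (φ : Brandt.ClassSet S.O → ℤ), φ ≠ 0 →
      Brandt.eigenLattice (Nplus * Nminus) (Brandt.matrix S.O) (fun n => W.LFunction n) = ℤ ∙ φ →
      ∃ c : Brandt.ClassSet S.O, ¬ (p : ℤ) ∣ (Brandt.weight S.O c : ℤ) * φ c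

end Fact

/-! ### The rendering, proved: "`⟨m, g_f⟩` is a unit for some `m ∈ ℳ`" ⟺ "some `w_c φ_c` is prime to `p`" -/

section Rendering

variable {ι : Type*} [Fintype ι] (p : ℕ) [Fact p.Prime]

/-- **Rendering of Pollack–Weston's Lemma 2.1 in coordinates** (the equivalence asserted in the
module docstring, PROVED): for the pairing `⟨e_c, e_d⟩ = w_c δ_{cd}` on `ℳ = ℤ_p^{ι}` (`ι = Cls O`)
and a vector `φ ∈ ℤ^{ι}`, some `m ∈ ℳ` has `⟨m, φ⟩ = Σ_c m_c w_c φ_c ∈ ℤ_pˣ` iff some `w_c φ_c` is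
prime to `p` (the image of `⟨·, φ⟩` is the ideal of `ℤ_p` generated by the `w_c φ_c`: if every
`w_c φ_c ∈ pℤ_p` so is every `⟨m, φ⟩`; conversely take `m = e_c` and use `‖k‖_p < 1 ↔ p ∣ k`).
[cite: PollackWeston2011, §2.1 Lemma 2.1] -/
theorem exists_isUnit_sum_mul_iff_exists_not_dvd (w : ι → ℕ) (φ : ι → ℤ) :
    (∃ m : ι → ℤ_[p], IsUnit (∑ c, m c * (((w c : ℤ) * φ c : ℤ) : ℤ_[p]))) ↔
      ∃ c, ¬ (p : ℤ) ∣ (w c : ℤ) * φ c := by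
  classical
  constructor
  · rintro ⟨m, hm⟩
    by_contra h
    simp only [not_exists, not_not] at h
    have hdvd : (p : ℤ_[p]) ∣ ∑ c, m c * (((w c : ℤ) * φ c : ℤ) : ℤ_[p]) :=
      Finset.dvd_sum fun c _ => by
        obtain ⟨k, hk⟩ := h c
        exact Dvd.dvd.mul_left ⟨(k : ℤ_[p]), by rw [hk]; push_cast; rfl⟩ _
    exact (mem_nonunits_iff.mp PadicInt.p_nonunit) (isUnit_of_dvd_unit hdvd hm)
  · rintro ⟨c, hc⟩
    refine ⟨Pi.single c 1, ?_⟩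
    -- the sum collapses to the integer `w_c φ_c`, a unit of `ℤ_p` since `‖k‖ < 1 ↔ p ∣ k`
    rw [Finset.sum_eq_single c (fun b _ hb => by rw [Pi.single_eq_of_ne hb, zero_mul])
      (fun h => absurd (Finset.mem_univ c) h), Pi.single_eq_same, one_mul, PadicInt.isUnit_iff]
    exact le_antisymm (PadicInt.norm_le_one _)
      (not_lt.mp fun hlt => hc ((PadicInt.norm_int_lt_one_iff_dvd _).mp hlt))

/-- **Lemma 2.1 in its printed shape**, from the named fact: under its hypotheses there is
`m ∈ ℳ = ℤ_p^{Cls O}` with `⟨m, g_f⟩ = Σ_c m_c w_c φ_c` a unit of `ℤ_p` ("There is some `m ∈ ℳ` such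
that `⟨m, g_f⟩` is a unit"). PROVED from the fact by `exists_isUnit_sum_mul_iff_exists_not_dvd`.
[cite: PollackWeston2011, §2.1 Lemma 2.1] -/
theorem pollackWeston2011_lemma21_exists_not_dvd_weight_mul.exists_isUnit_pairing
    (h : pollackWeston2011_lemma21_exists_not_dvd_weight_mul) (p : ℕ) [Fact p.Prime]
    (W : WeierstrassCurve ℚ) [W.IsElliptic] [W.IsGloballyMinimal] {Nplus Nminus : ℕ}
    (S : Brandt.XiSetup Nplus Nminus) [Fintype (Brandt.ClassSet S.O)] (hp : p ≠ 2)
    (hN : Nplus * Nminus = W.conductorNorm ℤ) (hsq : Squarefree (Nplus * Nminus))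
    (hpN : ¬ p ∣ Nplus * Nminus) (hsurj : Rank1Residual.Surj W p)
    (hram : ∀ q : ℕ, q.Prime → q ∣ Nminus → ¬ ((p : ℤ) ∣ padicValRat q W.Δ))
    (φ : Brandt.ClassSet S.O → ℤ) (hφ0 : φ ≠ 0)
    (hφ : Brandt.eigenLattice (Nplus * Nminus) (Brandt.matrix S.O) (fun n => W.LFunction n) = ℤ ∙ φ) :
    ∃ m : Brandt.ClassSet S.O → ℤ_[p],
      IsUnit (∑ c, m c * (((Brandt.weight S.O c : ℤ) * φ c : ℤ) : ℤ_[p])) :=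
  (exists_isUnit_sum_mul_iff_exists_not_dvd p (Brandt.weight S.O) φ).mpr
    (h p W S hp hN hsq hpN hsurj hram φ hφ0 hφ)

end Rendering

end Literature.NumberTheory.EllipticCurves

end
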